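import Mathlib
import HarnessLib

/-!
# Bachoc–Serra–Zémor, Theorem 34: the valuation step

Topic `Literature/Combinatorics/Additive`. Helper file for the discharge of
`Literature.Combinatorics.Additive.LinearVosperAlgClosed` (C. Bachoc, O. Serra, G. Zémor,
*An analogue of Vosper's theorem for extension fields*, Math. Proc. Cambridge Philos. Soc. 163
(2017), Theorem 34 = arXiv:1501.00602 §7 [BachocSerraZemor2017]); the assembly is in
`LinearVosperProofs.lean`.

This file formalises the part of the printed proof of Theorem 34 (loc. cit. p. 16) that uses a
valuation: given a valuation ring `O` of `L` containing `F` **with residue field `F`** (every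
`b ∈ O` is congruent to a scalar modulo the maximal ideal; such `O` exist when `F` is
algebraically closed, `Literature.RingTheory.Valuation.exists_valuationSubring_forall_sub_algebraMap_lt`),

* `exists_forall_valuation_le` — a non-zero finite-dimensional `F`-subspace `S ⊆ L` has a non-zero
  element of maximal valuation (any basis vector of maximal valuation);
* `finrank_add_one_of_forall_mem_iff` — removing the "top graded piece": if `τ ∈ T` has maximal
  valuation, `T' = {x ∈ T : v x < v τ}` has `dim T' = dim T - 1` (the graded pieces of `T` are at
  most one-dimensional because the residue field is `F`);
* `mul_lt_mul_of_forall_mem_iff` — then `S T' < S T` ("elements of `ST` of minimum valuation can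
  not exist in `ST'`", loc. cit.);
* `exists_le_finrank_eq_two` — hence, by induction on `dim T`, if `dim(ST) ≤ dim S + dim T - 1`
  there is a `2`-dimensional `A ⊆ T` with `dim(SA) ≤ dim S + 1` (the reduction with which the
  printed proof of Theorem 34 starts: "it suffices to show that there exists a space `A` of
  dimension `2` such that `dim(SA) = dim(S) + 1`").

We use Mathlib's multiplicative valuations (`O.valuation`, larger value = smaller additive
valuation), so the printed "minimum valuation" is a maximum here. The subspace `T'` is described
by its membership predicate (hypothesis `hT'`) and constructed inside the proof of
`exists_le_finrank_eq_two`, so that this file introduces no definitions.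
-/

namespace Literature.Combinatorics.Additive.BachocSerraZemor

open Module

variable {F L : Type*} [Field F] [Field L] [Algebra F L]
variable (O : ValuationSubring L)

/-- Scalars of `F ⊆ O` have valuation `1` (they and their inverses lie in `O`). [folklore] -/
theorem valuation_algebraMap_eq_one (hF : ∀ c : F, algebraMap F L c ∈ O) {c : F} (hc : c ≠ 0) :
    O.valuation (algebraMap F L c) = 1 := by
  refine le_antisymm ((O.valuation_le_one_iff _).mpr (hF c)) ?_
  have h : O.valuation (algebraMap F L c)⁻¹ ≤ 1 := by
    rw [← map_inv₀]
    exact (O.valuation_le_one_iff _).mpr (hF c⁻¹)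
  rw [map_inv₀] at h
  have hpos : 0 < O.valuation (algebraMap F L c) :=
    lt_of_le_of_ne zero_le (Ne.symm ((map_ne_zero O.valuation).mpr (by simpa using hc)))
  exact (inv_le_one₀ hpos).mp h

/-- Scaling by a non-zero scalar does not change the valuation. [folklore] -/
theorem valuation_smul (hF : ∀ c : F, algebraMap F L c ∈ O) {c : F} (hc : c ≠ 0) (x : L) :
    O.valuation (c • x) = O.valuation x := by
  rw [Algebra.smul_def, map_mul, valuation_algebraMap_eq_one O hF hc, one_mul]

/-- Scaling by a scalar does not increase the valuation. [folklore] -/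
theorem valuation_smul_le (hF : ∀ c : F, algebraMap F L c ∈ O) (c : F) (x : L) :
    O.valuation (c • x) ≤ O.valuation x := by
  rw [Algebra.smul_def, map_mul]
  calc O.valuation (algebraMap F L c) * O.valuation x ≤ 1 * O.valuation x :=
        mul_le_mul_of_nonneg_right ((O.valuation_le_one_iff _).mpr (hF c)) zero_le
    _ = O.valuation x := one_mul _

/-- **A finite-dimensional non-zero subspace has a non-zero element of maximal valuation**: a
basis vector of maximal valuation works, by the ultrametric inequality. [folklore] -/
theorem exists_forall_valuation_le (hF : ∀ c : F, algebraMap F L c ∈ O) (S : Submodule F L)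
    [FiniteDimensional F S] (hS : S ≠ ⊥) :
    ∃ s₀ ∈ S, s₀ ≠ 0 ∧ ∀ s ∈ S, O.valuation s ≤ O.valuation s₀ := by
  set b := Module.finBasis F S with hb
  have hn : 0 < finrank F S := by
    rw [pos_iff_ne_zero, Ne, Submodule.finrank_eq_zero]
    exact hS
  haveI : Nonempty (Fin (finrank F S)) := ⟨⟨0, hn⟩⟩
  obtain ⟨i₀, -, hi₀⟩ := Finset.exists_max_image Finset.univ
    (fun i => O.valuation ((b i : S) : L)) Finset.univ_nonempty
  refine ⟨b i₀, (b i₀).2, ?_, fun s hs => ?_⟩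
  · exact fun h => b.ne_zero i₀ (Subtype.ext h)
  · have hrepr : (∑ i, b.repr ⟨s, hs⟩ i • ((b i : S) : L)) = s := by
      have h1 := congrArg Subtype.val (b.sum_repr ⟨s, hs⟩)
      simp only [Submodule.coe_sum, Submodule.coe_smul] at h1
      exact h1
    rw [← hrepr]
    refine Valuation.map_sum_le _ fun i _ => ?_
    exact (valuation_smul_le O hF _ _).trans (hi₀ i (Finset.mem_univ i))

/-- **Graded pieces are at most one-dimensional** when the residue field is `F`: if
`v x ≤ v y` and `y ≠ 0` then `v (x - c • y) < v y` for some scalar `c`. [folklore] -/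
theorem exists_valuation_sub_smul_lt
    (hres : ∀ b ∈ O, ∃ c : F, O.valuation (b - algebraMap F L c) < 1) {x y : L} (hy : y ≠ 0)
    (hxy : O.valuation x ≤ O.valuation y) : ∃ c : F, O.valuation (x - c • y) < O.valuation y := by
  have hvy : O.valuation y ≠ 0 := (map_ne_zero O.valuation).mpr hy
  have hmem : x / y ∈ O := by
    rw [← O.valuation_le_one_iff, map_div₀]
    exact div_le_one_of_le₀ hxy zero_le
  obtain ⟨c, hc⟩ := hres _ hmem
  refine ⟨c, ?_⟩
  have hxc : x - c • y = (x / y - algebraMap F L c) * y := by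
    rw [Algebra.smul_def, sub_mul, div_mul_cancel₀ x hy]
  rw [hxc, map_mul]
  calc O.valuation (x / y - algebraMap F L c) * O.valuation y < 1 * O.valuation y :=
        mul_lt_mul_of_pos_right hc (lt_of_le_of_ne zero_le hvy.symm)
    _ = O.valuation y := one_mul _

/-- **Removing the top graded piece lowers the dimension by one.** Let `τ ∈ T` be non-zero of
maximal valuation in the finite-dimensional subspace `T`, and let `T'` be the subspace of
elements of `T` of valuation `< v τ` (described by `hT'`). Then `dim T' + 1 = dim T`: indeed
`T = T' ⊕ Fτ`, because for `x ∈ T` some `x - c τ` has smaller valuation. [folklore] -/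
theorem finrank_add_one_of_forall_mem_iff (hF : ∀ c : F, algebraMap F L c ∈ O)
    (hres : ∀ b ∈ O, ∃ c : F, O.valuation (b - algebraMap F L c) < 1)
    (T : Submodule F L) [FiniteDimensional F T] {τ : L} (hτT : τ ∈ T) (hτ : τ ≠ 0)
    (hmax : ∀ t ∈ T, O.valuation t ≤ O.valuation τ) (T' : Submodule F L)
    (hT' : ∀ x, x ∈ T' ↔ x ∈ T ∧ O.valuation x < O.valuation τ) :
    finrank F T' + 1 = finrank F T := by
  have hT'T : T' ≤ T := fun x hx => ((hT' x).mp hx).1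
  haveI : FiniteDimensional F T' := Submodule.finiteDimensional_of_le hT'T
  have hsup : T' ⊔ F ∙ τ = T := by
    refine le_antisymm (sup_le hT'T ((Submodule.span_singleton_le_iff_mem τ T).mpr hτT)) ?_
    intro x hx
    obtain ⟨c, hc⟩ := exists_valuation_sub_smul_lt O hres hτ (hmax x hx)
    rw [show x = (x - c • τ) + c • τ by abel]
    refine Submodule.add_mem_sup ((hT' _).mpr ⟨?_, hc⟩) (Submodule.mem_span_singleton.mpr ⟨c, rfl⟩)
    exact T.sub_mem hx (T.smul_mem c hτT)
  have hinf : T' ⊓ F ∙ τ = ⊥ := by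
    rw [eq_bot_iff]
    intro x ⟨hx1, hx2⟩
    obtain ⟨c, rfl⟩ := Submodule.mem_span_singleton.mp hx2
    by_cases hc : c = 0
    · simp [hc]
    · exfalso
      have h := ((hT' _).mp hx1).2
      rw [valuation_smul O hF hc] at h
      exact lt_irrefl _ h
  have h := Submodule.finrank_sup_add_finrank_inf_eq T' (F ∙ τ)
  rw [hsup, hinf, finrank_bot, add_zero, finrank_span_singleton hτ] at h
  exact h.symm

/-- **"Elements of `ST` of minimum valuation can not exist in `ST'`"** (Bachoc–Serra–Zémor,
proof of Thm 34): for `τ ∈ T`, a subspace `T' ⊆ {x ∈ T : v x < v τ}` (described by `hT'`) and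
`S ≠ 0` finite-dimensional, `S T' < S T`: if `s₀ ∈ S` has maximal valuation then `s₀ τ ∈ ST`
while every element of `ST'` has valuation `< v(s₀) v(τ)`.
[cite: BachocSerraZemor2017, proof of Thm 34 (§7, p. 16)] -/
theorem mul_lt_mul_of_forall_mem_iff (hF : ∀ c : F, algebraMap F L c ∈ O)
    (S T : Submodule F L) [FiniteDimensional F S] (hS : S ≠ ⊥) {τ : L} (hτT : τ ∈ T)
    (T' : Submodule F L) (hT' : ∀ x, x ∈ T' ↔ x ∈ T ∧ O.valuation x < O.valuation τ) :
    S * T' < S * T := by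
  have hT'T : T' ≤ T := fun x hx => ((hT' x).mp hx).1
  obtain ⟨s₀, hs₀S, hs₀, hs₀max⟩ := exists_forall_valuation_le O hF S hS
  refine lt_of_le_of_ne (mul_le_mul_right hT'T S) fun heq => ?_
  have hvs₀ : 0 < O.valuation s₀ :=
    lt_of_le_of_ne zero_le (Ne.symm ((map_ne_zero O.valuation).mpr hs₀))
  have hlt : ∀ z ∈ S * T', O.valuation z < O.valuation s₀ * O.valuation τ := by
    intro z hz
    refine Submodule.mul_induction_on hz (fun m hm n hn => ?_) (fun x y hx hy => ?_)
    · rw [map_mul]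
      calc O.valuation m * O.valuation n ≤ O.valuation s₀ * O.valuation n :=
            mul_le_mul_of_nonneg_right (hs₀max m hm) zero_le
        _ < O.valuation s₀ * O.valuation τ :=
            mul_lt_mul_of_pos_left ((hT' n).mp hn).2 hvs₀
    · exact Valuation.map_add_lt _ hx hy
  have hmem : s₀ * τ ∈ S * T' := heq ▸ Submodule.mul_mem_mul hs₀S hτT
  have h := hlt _ hmem
  rw [map_mul] at h
  exact lt_irrefl _ h

/-- **Reduction to `dim T = 2`** (Bachoc–Serra–Zémor, proof of Thm 34, first paragraph, over a
valuation ring with residue field `F`): if `S ≠ 0` and `T` are finite-dimensional with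
`dim T ≥ 2` and `dim(ST) ≤ dim S + dim T - 1`, then some `2`-dimensional `A ⊆ T` has
`dim(SA) ≤ dim S + 1`. Induction on `dim T`: replace `T` by `T'` (top graded piece removed), for
which `dim(ST') < dim(ST)`. [cite: BachocSerraZemor2017, proof of Thm 34 (§7, p. 16)] -/
theorem exists_le_finrank_eq_two (hF : ∀ c : F, algebraMap F L c ∈ O)
    (hres : ∀ b ∈ O, ∃ c : F, O.valuation (b - algebraMap F L c) < 1)
    (S : Submodule F L) [FiniteDimensional F S] (hS : S ≠ ⊥) (n : ℕ) :
    ∀ (T : Submodule F L), FiniteDimensional F T → finrank F T = n + 2 →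
      finrank F ↥(S * T) ≤ finrank F S + finrank F T - 1 →
        ∃ A : Submodule F L, A ≤ T ∧ finrank F A = 2 ∧
          finrank F ↥(S * A) ≤ finrank F S + 1 := by
  induction n with
  | zero =>
    intro T _ hT hST
    exact ⟨T, le_rfl, hT, by omega⟩
  | succ n ih =>
    intro T _ hT hST
    have hTne : T ≠ ⊥ := by
      rw [Ne, ← Submodule.finrank_eq_zero, hT]
      omega
    obtain ⟨τ, hτT, hτ, hmax⟩ := exists_forall_valuation_le O hF T hTne
    have hvτ : 0 < O.valuation τ :=
      lt_of_le_of_ne zero_le (Ne.symm ((map_ne_zero O.valuation).mpr hτ))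
    -- the subspace of elements of `T` of valuation `< v τ`
    let T' : Submodule F L :=
      { carrier := {x | x ∈ T ∧ O.valuation x < O.valuation τ}
        add_mem' := fun {x y} hx hy => ⟨T.add_mem hx.1 hy.1, Valuation.map_add_lt _ hx.2 hy.2⟩
        zero_mem' := ⟨T.zero_mem, by simpa using hvτ⟩
        smul_mem' := fun c x hx =>
          ⟨T.smul_mem c hx.1, (valuation_smul_le O hF c x).trans_lt hx.2⟩ }
    have hT' : ∀ x, x ∈ T' ↔ x ∈ T ∧ O.valuation x < O.valuation τ := fun x => Iff.rfl
    have hT'T : T' ≤ T := fun x hx => ((hT' x).mp hx).1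
    haveI : FiniteDimensional F T' := Submodule.finiteDimensional_of_le hT'T
    have hdim : finrank F T' + 1 = finrank F T :=
      finrank_add_one_of_forall_mem_iff O hF hres T hτT hτ hmax T' hT'
    have hlt : S * T' < S * T := mul_lt_mul_of_forall_mem_iff O hF S T hS hτT T' hT'
    haveI : FiniteDimensional F ↥(S * T) :=
      Module.Finite.iff_fg.mpr ((Module.Finite.iff_fg.mp ‹FiniteDimensional F S›).mul
        (Module.Finite.iff_fg.mp ‹FiniteDimensional F T›))
    have hlt' := Submodule.finrank_lt_finrank_of_lt hlt
    obtain ⟨A, hAT', hA, hSA⟩ := ih T' inferInstance (by omega) (by omega)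
    exact ⟨A, hAT'.trans hT'T, hA, hSA⟩

end Literature.Combinatorics.Additive.BachocSerraZemor
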